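import Summits.QuantumAdvantage.QuantumAdvantage.Theses.RandomOracleGauge
import Literature.Computability.QuantumComplexity.InfluenceBounds

/-!
# Crux `OneBlockDecoupling` (stmt-QuantumAdvantage-17873) — line `odonnell-zhao`

Skeleton of O'Donnell–Zhao, *Polynomial bounds for decoupling*, arXiv:1512.01603, Cor. 2.12 + proof of
Thm. 2.13, in the tree's vocabulary (`cubeFourierCoeff`, `walsh`/`sgn` of `BooleanFourier.lean`,
`evalBool`/`boolVariance`/`influence` of `AaronsonAmbainis.lean`). With `p̂ = cubeFourierCoeff (evalBool p)`
the ONE-BLOCK-DECOUPLED function of `p` is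
  `dec p (y,z) = Σ_S p̂(S) Σ_{i∈S} sgn(y_i) Π_{j∈S∖i} sgn(z_j)`  (= `f̃/2` for `f = 2p − 1`, OZ Def. 1.1).
* `stub_supBound` (OZ Cor. 2.12, H2 case; size L): `|dec p| ≤ K d^κ` for `[0,1]`-bounded `p` of degree
  `≤ d` — via Lemma 4.1 (`f̃(y,z) = Σ_l c_l F(α_l y + β_l z)`, `|α_l|+|β_l| = 1`, `‖c‖₁ = O(d²)` from an
  explicit Vandermonde inverse) and `|F(t)| ≤ 1` on `[−1,1]^N` for the multilinear extension `F` of `f`;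
* `stub_realisation` (size M): `1/2 + dec p/(2C)` is the cube function of a `[0,1]`-bounded,
  one-block-decoupled `q : ℝ[Fin (N+N)]` of total degree `≤ d` (uses `p̂(S) = 0` for `|S| > d`,
  `cubeFourierCoeff_evalBool_eq_zero`);
* `stub_comparison` (size M): Parseval for the (distinct, mean-zero) characters `sgn(y_i)·χ_{S∖i}(z)` on the
  `2N`-cube: `Var p ≤ 4C² Var q`, `Inf_{y_i} q = Inf_i p/(4C²)`, `Inf_{z_j} q ≤ (d−1) Inf_j p/(4C²)`.
The composition `OneBlockDecoupling_of` is kernel-checked below (sorries only in the three stubs).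
-/

set_option linter.dupNamespace false

open Finset
open Literature.Computability.QuantumComplexity
open Literature.Probability.RandomGraphs.LowDegree (sgn walsh)
open Literature.Computability.Complexity.LowDegree (cubeFourierCoeff)
open Summit.QuantumAdvantage.QuantumAdvantage.Theses.RandomOracleGauge

namespace Summit.QuantumAdvantage.QuantumAdvantage.Cruxes.OneBlockDecoupling.OdonnellZhao

/-! ### Named statements of the stubs (verbatim; `Registered.stub_*` below are the name-keyed aliases used as the
hypotheses of `OneBlockDecoupling_of` — the native skeleton audit admits a hypothesis by the last name component of its head) -/

/-- Statement of `stub_supBound` (verbatim). -/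
abbrev SupBoundStmt : Prop :=
    ∃ (κ : ℕ) (K : ℝ), 0 < K ∧ ∀ (N d : ℕ) (p : MvPolynomial (Fin N) ℝ), 1 ≤ d → p.totalDegree ≤ d →
      (∀ x, 0 ≤ evalBool p x ∧ evalBool p x ≤ 1) → ∀ (y z : Fin N → Bool),
        |∑ S : Finset (Fin N), cubeFourierCoeff (evalBool p) S *
            ∑ i ∈ S, sgn (y i) * ∏ j ∈ S.erase i, sgn (z j)| ≤ K * (d : ℝ) ^ κ

/-- Statement of `stub_realisation` (verbatim). -/
abbrev RealisationStmt : Prop :=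
    ∀ (N d : ℕ) (p : MvPolynomial (Fin N) ℝ) (C : ℝ), 0 < C → p.totalDegree ≤ d →
      (∀ (y z : Fin N → Bool),
        |∑ S : Finset (Fin N), cubeFourierCoeff (evalBool p) S *
            ∑ i ∈ S, sgn (y i) * ∏ j ∈ S.erase i, sgn (z j)| ≤ C) →
      ∃ q : MvPolynomial (Fin (N + N)) ℝ, q.totalDegree ≤ d ∧
        (∀ (y z : Fin N → Bool), evalBool q (Fin.append y z) =
          1 / 2 + (∑ S : Finset (Fin N), cubeFourierCoeff (evalBool p) S *
            ∑ i ∈ S, sgn (y i) * ∏ j ∈ S.erase i, sgn (z j)) / (2 * C)) ∧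
        (∀ x, 0 ≤ evalBool q x ∧ evalBool q x ≤ 1) ∧
        (∃ (c₀ : ℝ) (g : Fin N → (Fin N → Bool) → ℝ), ∀ (y z : Fin N → Bool),
          evalBool q (Fin.append y z) = c₀ + ∑ i, (if y i then (1 : ℝ) else -1) * g i z)

/-- Statement of `stub_comparison` (verbatim). -/
abbrev ComparisonStmt : Prop :=
    ∀ (N d : ℕ) (p : MvPolynomial (Fin N) ℝ) (C : ℝ) (q : MvPolynomial (Fin (N + N)) ℝ), 1 ≤ d →
      p.totalDegree ≤ d → 0 < C →
      (∀ (y z : Fin N → Bool), evalBool q (Fin.append y z) =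
          1 / 2 + (∑ S : Finset (Fin N), cubeFourierCoeff (evalBool p) S *
            ∑ i ∈ S, sgn (y i) * ∏ j ∈ S.erase i, sgn (z j)) / (2 * C)) →
      boolVariance p ≤ 4 * C ^ 2 * boolVariance q ∧
      ∀ j : Fin (N + N), ∃ i : Fin N, influence j q ≤ d / C ^ 2 * influence i p

/-- STUB (O'Donnell–Zhao Cor. 2.12 in the Boolean case H2; size L). The one-block-decoupled function of
a `[0,1]`-bounded polynomial of degree `≤ d` is bounded by `K d^κ` (OZ: `O(d²)·‖2p−1‖_∞`).
[cite: arXiv:1512.01603, Cor. 2.12, Lemma 4.1] -/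
theorem stub_supBound :
    ∃ (κ : ℕ) (K : ℝ), 0 < K ∧ ∀ (N d : ℕ) (p : MvPolynomial (Fin N) ℝ), 1 ≤ d → p.totalDegree ≤ d →
      (∀ x, 0 ≤ evalBool p x ∧ evalBool p x ≤ 1) → ∀ (y z : Fin N → Bool),
        |∑ S : Finset (Fin N), cubeFourierCoeff (evalBool p) S *
            ∑ i ∈ S, sgn (y i) * ∏ j ∈ S.erase i, sgn (z j)| ≤ K * (d : ℝ) ^ κ := by
  sorry

/-- STUB (realisation; size M). `1/2 + dec p/(2C)` is the cube function of a `[0,1]`-bounded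
one-block-decoupled polynomial on `Fin (N+N)` (blocks = `Fin.append y z`) of total degree `≤ d`.
[cite: arXiv:1512.01603, proof of Thm. 2.13] -/
theorem stub_realisation :
    ∀ (N d : ℕ) (p : MvPolynomial (Fin N) ℝ) (C : ℝ), 0 < C → p.totalDegree ≤ d →
      (∀ (y z : Fin N → Bool),
        |∑ S : Finset (Fin N), cubeFourierCoeff (evalBool p) S *
            ∑ i ∈ S, sgn (y i) * ∏ j ∈ S.erase i, sgn (z j)| ≤ C) →
      ∃ q : MvPolynomial (Fin (N + N)) ℝ, q.totalDegree ≤ d ∧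
        (∀ (y z : Fin N → Bool), evalBool q (Fin.append y z) =
          1 / 2 + (∑ S : Finset (Fin N), cubeFourierCoeff (evalBool p) S *
            ∑ i ∈ S, sgn (y i) * ∏ j ∈ S.erase i, sgn (z j)) / (2 * C)) ∧
        (∀ x, 0 ≤ evalBool q x ∧ evalBool q x ≤ 1) ∧
        (∃ (c₀ : ℝ) (g : Fin N → (Fin N → Bool) → ℝ), ∀ (y z : Fin N → Bool),
          evalBool q (Fin.append y z) = c₀ + ∑ i, (if y i then (1 : ℝ) else -1) * g i z) := by
  sorry

/-- STUB (Parseval comparison; size M). For `q` realising `1/2 + dec p/(2C)`: `Var p ≤ 4C² Var q`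
(`Var q = Σ_S |S| p̂(S)²/(4C²) ≥ Var p/(4C²)`) and every influence of `q` is `≤ (d/C²)·`(an influence of
`p`) (`Inf_{y_i} q = Inf_i p/(4C²)`, `Inf_{z_j} q = Σ_{S∋j}(|S|−1)p̂(S)²/C² ≤ (d−1)Inf_j p/(4C²)`; tree:
`influence_eq_sum_sq_fourier`). [cite: arXiv:1512.01603, proof of Thm. 2.13] -/
theorem stub_comparison :
    ∀ (N d : ℕ) (p : MvPolynomial (Fin N) ℝ) (C : ℝ) (q : MvPolynomial (Fin (N + N)) ℝ), 1 ≤ d →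
      p.totalDegree ≤ d → 0 < C →
      (∀ (y z : Fin N → Bool), evalBool q (Fin.append y z) =
          1 / 2 + (∑ S : Finset (Fin N), cubeFourierCoeff (evalBool p) S *
            ∑ i ∈ S, sgn (y i) * ∏ j ∈ S.erase i, sgn (z j)) / (2 * C)) →
      boolVariance p ≤ 4 * C ^ 2 * boolVariance q ∧
      ∀ j : Fin (N + N), ∃ i : Fin N, influence j q ≤ d / C ^ 2 * influence i p := by
  sorry

namespace Registered

/-- Alias of `stub_supBound`'s statement keyed by the registered stub name. -/
abbrev stub_supBound : Prop := SupBoundStmt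
/-- Alias of `stub_realisation`'s statement keyed by the registered stub name. -/
abbrev stub_realisation : Prop := RealisationStmt
/-- Alias of `stub_comparison`'s statement keyed by the registered stub name. -/
abbrev stub_comparison : Prop := ComparisonStmt

end Registered

/-- COMPOSITION (kernel-checked): the three stubs give the crux `OneBlockDecoupling` by name, with
`κ' = 2κ + 1`, `K' = 4K² + K⁻²`. -/
theorem OneBlockDecoupling_of (hSup : Registered.stub_supBound) (hReal : Registered.stub_realisation) (hCmp : Registered.stub_comparison) :
    OneBlockDecoupling := by
  obtain ⟨κ, K, hK, hS⟩ := hSup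
  refine ⟨2 * κ + 1, 4 * K ^ 2 + (K ^ 2)⁻¹, by positivity, ?_⟩
  intro N d p hd hdeg hb
  have hd1 : (1 : ℝ) ≤ d := by exact_mod_cast hd
  set C : ℝ := K * (d : ℝ) ^ κ with hCdef
  have hC : 0 < C := by positivity
  obtain ⟨q, hqdeg, hqf, hqb, hqdec⟩ := hReal N d p C hC hdeg (hS N d p hd hdeg hb)
  obtain ⟨hvar, hinf⟩ := hCmp N d p C q hd hdeg hC hqf
  refine ⟨q, hqdec, hqdeg, hqb, ?_, ?_⟩
  · -- Var p ≤ 4 C² Var q ≤ (4K² + K⁻²) d^{2κ+1} Var q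
    have hVq : 0 ≤ boolVariance q := boolVariance_nonneg q
    have hC2 : 4 * C ^ 2 ≤ (4 * K ^ 2 + (K ^ 2)⁻¹) * (d : ℝ) ^ (2 * κ + 1) := by
      have h1 : 4 * C ^ 2 = 4 * K ^ 2 * (d : ℝ) ^ (2 * κ) := by rw [hCdef, mul_pow, ← pow_mul, mul_comm κ 2]; ring
      rw [h1]
      have hdp : (d : ℝ) ^ (2 * κ) ≤ (d : ℝ) ^ (2 * κ + 1) := pow_le_pow_right₀ hd1 (Nat.le_succ _)
      have hKle : 4 * K ^ 2 ≤ 4 * K ^ 2 + (K ^ 2)⁻¹ := le_add_of_nonneg_right (by positivity)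
      calc 4 * K ^ 2 * (d : ℝ) ^ (2 * κ) ≤ 4 * K ^ 2 * (d : ℝ) ^ (2 * κ + 1) :=
            mul_le_mul_of_nonneg_left hdp (by positivity)
        _ ≤ (4 * K ^ 2 + (K ^ 2)⁻¹) * (d : ℝ) ^ (2 * κ + 1) :=
            mul_le_mul_of_nonneg_right hKle (by positivity)
    calc boolVariance p ≤ 4 * C ^ 2 * boolVariance q := hvar
      _ ≤ (4 * K ^ 2 + (K ^ 2)⁻¹) * (d : ℝ) ^ (2 * κ + 1) * boolVariance q :=
          mul_le_mul_of_nonneg_right hC2 hVq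
  · intro j
    obtain ⟨i, hi⟩ := hinf j
    refine ⟨i, hi.trans ?_⟩
    have hIp : 0 ≤ influence i p := influence_nonneg i p
    apply mul_le_mul_of_nonneg_right _ hIp
    -- d / C² = d / (K² d^{2κ}) ≤ d / K² ≤ (4K² + K⁻²) d^{2κ+1}
    have hden : K ^ 2 ≤ C ^ 2 := by
      rw [hCdef, mul_pow]
      have : (1 : ℝ) ≤ ((d : ℝ) ^ κ) ^ 2 := one_le_pow₀ (one_le_pow₀ hd1)
      nlinarith [sq_nonneg K]
    calc (d : ℝ) / C ^ 2 ≤ (d : ℝ) / K ^ 2 := div_le_div_of_nonneg_left (by positivity) (by positivity) hden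
      _ = (K ^ 2)⁻¹ * (d : ℝ) ^ 1 := by rw [pow_one, div_eq_mul_inv, mul_comm]
      _ ≤ (4 * K ^ 2 + (K ^ 2)⁻¹) * (d : ℝ) ^ (2 * κ + 1) := by
          apply mul_le_mul (le_add_of_nonneg_left (by positivity))
            (pow_le_pow_right₀ hd1 (by omega)) (by positivity) (by positivity)

/-- Wiring check: the stub theorems feed `OneBlockDecoupling_of` as stated (the verbatim restatements are definitionally the
registered aliases). An unnamed `example`, so that `OneBlockDecoupling_of` stays the only declaration concluding the crux by name. -/
example : OneBlockDecoupling :=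
  OneBlockDecoupling_of stub_supBound stub_realisation stub_comparison

end Summit.QuantumAdvantage.QuantumAdvantage.Cruxes.OneBlockDecoupling.OdonnellZhao
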